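import Mathlib
import Summits.Ventures.FusionMHD.Models.CerfonFreidbergIterLikeQHalfObligation
import HarnessLib

/-!
# Ventures/FusionMHD — Models/CerfonFreidbergIterLikeQHalfPanels7.lean: KERNEL CHECK of panels 29, 30, 31 (of 32) of the
# certified interior safety factor `q(ψ_N = 1/2)/F` of THE Cerfon–Freidberg ITER-like instance

HONEST FRAMING (LADDER-GRIDFUSION three columns; CF rung, F2 item R2).  One `decide +kernel` (≈ 129 s on the farm): for each panel `j` listed,
the per-panel obligation `QHalf.PanelCert.ok` (`Models/CerfonFreidbergIterLikeQHalfObligation.lean`) — the Taylor-model run of `QHalf.progG`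
(`Models/CerfonFreidbergIterLikeQHalfDefs.lean`) over the parameter box is ACCEPTED (every `log`/`sin`/`cos` composition and the `inv`
certificate), and the kernel's panel-integral enclosure of the polar `(6.35)` integrand along the approximant, the range of the flux residual
`U(ray m) − U_a/2`, the range of the approximant `m` and the range of the radial derivative `D_r(θ, m)` lie inside the integers claimed in
`panelCert7` (values read off a compiled `#eval` of the same functions, slack one unit of `2⁻⁶⁰`).  What these Booleans MEAN (real-number
statements, uniformly over the parameter box ∋ THE instance) is proved once in `Models/CerfonFreidbergIterLikeQHalfSound.lean`; the
assembly is `Models/CerfonFreidbergIterLikeQHalf.lean`.  MODELLED: analytic Cerfon–Freidberg family; `q` of a MODEL surface — nothing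
about a device or stability.  No `native_decide`.  Typer/prover: gridfusion-model-5 (g7), 2026-08-27.
Citations: Freidberg 2014 §6.3.5 (6.35) [Freidberg2014]; Mahboubi–Melquiond–Sibut-Pinote 2016 §3.2 Lemma 3 [MahboubiMelquiondSibutpinote2016].
-/

namespace Summit.Ventures.FusionMHD.Models.CFIterLike.QHalf

/-- The certificate data of panels 29, 30, 31: `inv` candidate (degree-8 fit of `(X·D_r)⁻¹` in the panel variable, scaled by `2⁶⁰`), Taylor
degree, `inv` widening `2^elog2`, and the claimed integral / residual / `m`-range / `D_r`-range integers (× `2⁶⁰`). [instance data] -/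
def panelCert7 : List PanelCert := [
  { j := 29, cand := [11014054156787177472, -6929496252021100544, 46362396834882338816, -24480235120145723392, 54921098974164221952, 230894838211812687872, -1086668575339661754368, 3933155473801115860992, -11958574834255086485504],
    deg := 12, elog2 := 35, plo := 268605443484300591, phi := 268605445532370404, eta := 77491728, mlo := 283382606820210100, mhi := 289019813199958279,
    dlo := 148202908377060463, dhi := 151769376249087634 },
  { j := 30, cand := [10842094449581240320, -4095931982916963328, 44446265426011799552, -15910630761533505536, 78563483719166394368, 90056564845234077696, -494970051857669423104, 1730542698506220732416, -6351973562812821667840],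
    deg := 12, elog2 := 35, plo := 260658197136380290, phi := 260658199160074217, eta := 80300716, mlo := 280382037515579987, mhi := 283914533961939879,
    dlo := 151453866993742685, dhi := 153759840548466302 },
  { j := 31, cand := [10757092768955209728, -1354712518804336384, 43436305620714536960, -5464949515923889152, 86845831942808485888, 23110775861901819904, -263972001392295215104, 484571142306597502976, -4056207637137780113408],
    deg := 12, elog2 := 37, plo := 256771887580208944, phi := 256771895549099659, eta := 298094316, mlo := 279392735089908728, mhi := 280893331034225421,
    dlo := 153432639571029132, dhi := 154429213034228983 }]

/-- **KERNEL CHECK** of panels 29, 30, 31. -/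
theorem panelCert7_ok : panelCert7.all PanelCert.ok = true := by
  decide +kernel

end Summit.Ventures.FusionMHD.Models.CFIterLike.QHalf
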